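import Mathlib
import Literature.Analysis.ODE.SaddleEscapeComparison

/-!
# Infall down an exponential tail: the retarded lag is at least `(log 2)/κ`

Companion of `SaddleEscapeComparison.lean` (escape over a barrier top) for the other side of a
barrier. Consider the Hamiltonian ray `X′ = ξ/ω₀`, `ξ′ = −q′(X)/(2ω₀)`, `ω₀² = q(x₀)`, released
at rest at `x₀` on the INCREASING side of a positive `C²` profile `q` (`q′ ≥ 0` on `(−∞, xc]`,
`x₀ < xc`, `q′(x₀) > 0`), so that it falls toward `−∞` (`trajectory_monotone`, reflected), and
suppose the profile dominates an exponential below the launch point,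
`q(x) ≥ q(x₀) e^{−2κ(x₀ − x)}` for `x ≤ x₀`. By conservation of `ξ² + q(X)` the fall
`u = x₀ − X` satisfies `u′ = √(1 − q(X)/q(x₀)) ≤ √(1 − e^{−2κu})`: position for position the ray
is slower than the ray of the pure exponential profile `q₀e^{2κ(x − x₀)}`, whose retarded lag
`t − u` increases to `(log 2)/κ` — for `q = m²e^{2κx}`, `κ = 1/(4M)` the surface gravity, this is
the Rindler "midpoint law": a particle dropped from rest crosses the future horizon at Kruskal
`V = 2X₁`, i.e. lags `4M log 2` behind the light ray from its starting point. Consequently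
(`infall_lag_ge`) for every `ε > 0` there is a time `T > 0` at which the lag of the true ray is
`≥ (log 2)/κ − ε`. The comparison clock is `G(t) = t − u − g(u)`,
`g(u) = κ⁻¹ log(1 + √(1 − e^{−2κu}))` (`g′ = 1/√(1 − e^{−2κu}) − 1`), which is non-decreasing
along the ray. Used by the near-side lag law of the photon-sphere channels
(`Summit…Theorems.LagLaw.stub_lagLawNear`). Standard material [folklore].
-/

noncomputable section

namespace Literature.Analysis.ODE

open Set Filter Topology

/-- Derivative of the exponential-tail lag clock `g(v) = log(1 + √(1 − e^{−2κv}))` at `v > 0`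
(without the factor `κ⁻¹`): `g′(v) = κ (1/√(1 − e^{−2κv}) − 1)`. [folklore] -/
theorem hasDerivAt_infallClock {κ v : ℝ} (hκ : 0 < κ) (hv : 0 < v) :
    HasDerivAt (fun v => Real.log (1 + Real.sqrt (1 - Real.exp (-(2 * κ * v)))))
      (κ * (1 / Real.sqrt (1 - Real.exp (-(2 * κ * v))) - 1)) v := by
  set z : ℝ := Real.exp (-(2 * κ * v)) with hz
  have hz1 : z < 1 := by
    rw [hz]; exact Real.exp_lt_one_iff.2 (by nlinarith)
  have hz0 : 0 < z := Real.exp_pos _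
  have hf0 : 0 < 1 - z := by linarith
  set s : ℝ := Real.sqrt (1 - z) with hs
  have hs0 : 0 < s := Real.sqrt_pos.2 hf0
  have hs2 : s ^ 2 = 1 - z := Real.sq_sqrt hf0.le
  -- the inner function `1 − e^{−2κv}`
  have h1 : HasDerivAt (fun v => 1 - Real.exp (-(2 * κ * v))) (2 * κ * z) v := by
    have he : HasDerivAt (fun v => Real.exp (-(2 * κ * v))) (z * (-(2 * κ))) v := by
      have hl : HasDerivAt (fun v : ℝ => -(2 * κ * v)) (-(2 * κ)) v := by
        have h := (hasDerivAt_id v).const_mul (-(2 * κ))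
        rw [mul_one] at h
        exact h.congr_of_eventuallyEq (Eventually.of_forall fun y => by simp only [id]; ring)
      exact (Real.hasDerivAt_exp _).comp v hl |>.congr_deriv (by rw [hz])
    have := he.const_sub 1
    exact this.congr_deriv (by ring)
  have h2 : HasDerivAt (fun v => Real.sqrt (1 - Real.exp (-(2 * κ * v)))) (2 * κ * z / (2 * s)) v := by
    have := h1.sqrt hf0.ne'
    exact this.congr_deriv (by rw [hs])
  have h3 : HasDerivAt (fun v => 1 + Real.sqrt (1 - Real.exp (-(2 * κ * v)))) (2 * κ * z / (2 * s)) v :=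
    h2.const_add 1
  have h4 := h3.log (by positivity : (1 + Real.sqrt (1 - Real.exp (-(2 * κ * v)))) ≠ 0)
  refine h4.congr_deriv ?_
  rw [← hs]
  have hzs : z = 1 - s ^ 2 := by rw [hs2]; ring
  rw [hzs]
  field_simp
  ring

/-- The exponential-tail lag clock tends to `log 2` from below: for every `ε > 0`,
`κ⁻¹ log(1 + √(1 − e^{−2κv})) ≥ (log 2)/κ − ε` for all large `v`. [folklore] -/
theorem infallClock_eventually_ge {κ ε : ℝ} (hκ : 0 < κ) (hε : 0 < ε) :
    ∃ V : ℝ, 0 < V ∧ ∀ v : ℝ, V ≤ v →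
      Real.log 2 / κ - ε ≤ 1 / κ * Real.log (1 + Real.sqrt (1 - Real.exp (-(2 * κ * v)))) := by
  -- `z ≤ δ₀ := 2(1 − e^{−κε})` suffices, since `1 + √(1−z) ≥ 2 − z ≥ 2e^{−κε}`
  set δ₀ : ℝ := 2 * (1 - Real.exp (-(κ * ε))) with hδ₀
  have hδ₀0 : 0 < δ₀ := by
    rw [hδ₀]
    have : Real.exp (-(κ * ε)) < 1 := Real.exp_lt_one_iff.2 (by nlinarith)
    linarith
  refine ⟨max 1 (-Real.log δ₀ / (2 * κ)), lt_max_of_lt_left one_pos, fun v hv => ?_⟩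
  have hv1 : 1 ≤ v := le_trans (le_max_left _ _) hv
  have hv2 : -Real.log δ₀ / (2 * κ) ≤ v := le_trans (le_max_right _ _) hv
  set z : ℝ := Real.exp (-(2 * κ * v)) with hz
  have hz0 : 0 < z := Real.exp_pos _
  have hz1 : z < 1 := by rw [hz]; exact Real.exp_lt_one_iff.2 (by nlinarith)
  have hzδ : z ≤ δ₀ := by
    rw [hz]
    calc Real.exp (-(2 * κ * v)) ≤ Real.exp (Real.log δ₀) := by
          apply Real.exp_le_exp.2
          rw [div_le_iff₀ (by positivity)] at hv2
          linarith
      _ = δ₀ := Real.exp_log hδ₀0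
  have hsq : 1 - z ≤ Real.sqrt (1 - z) :=
    calc 1 - z = Real.sqrt ((1 - z) ^ 2) := (Real.sqrt_sq (by linarith)).symm
      _ ≤ Real.sqrt (1 - z) := Real.sqrt_le_sqrt (by nlinarith)
  have hlow : 2 * Real.exp (-(κ * ε)) ≤ 1 + Real.sqrt (1 - z) := by
    have : 2 - z ≤ 1 + Real.sqrt (1 - z) := by linarith
    have : 2 * Real.exp (-(κ * ε)) = 2 - δ₀ := by rw [hδ₀]; ring
    linarith
  have hlog : Real.log 2 - κ * ε ≤ Real.log (1 + Real.sqrt (1 - z)) := by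
    have h := Real.log_le_log (by positivity) hlow
    rwa [Real.log_mul (by norm_num) (Real.exp_pos _).ne', Real.log_exp] at h
  rw [div_sub' (hc := hκ.ne'), div_le_iff₀ hκ, one_div, inv_mul_eq_div, div_mul_cancel₀ _ hκ.ne']
  linarith

/-- **Infall lag comparison.** See the module docstring. [folklore] -/
theorem infall_lag_ge {q X ξ : ℝ → ℝ} {ω₀ x₀ xc κ : ℝ} (hω₀ : 0 < ω₀) (hω₀q : ω₀ ^ 2 = q x₀)
    (hκ : 0 < κ) (hq : ContDiff ℝ 2 q)
    (hX : ∀ t, HasDerivAt X (ξ t / ω₀) t) (hξ : ∀ t, HasDerivAt ξ (-(deriv q (X t)) / (2 * ω₀)) t)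
    (hX0 : X 0 = x₀) (hξ0 : ξ 0 = 0) (hxc : x₀ < xc)
    (hq' : ∀ x, x ≤ xc → 0 ≤ deriv q x) (hq'0 : 0 < deriv q x₀)
    (hcmp : ∀ x, x ≤ x₀ → q x₀ * Real.exp (-(2 * κ * (x₀ - x))) ≤ q x) :
    (∀ t, 0 ≤ t → X t ≤ x₀) ∧
      ∀ ε : ℝ, 0 < ε → ∃ T : ℝ, 0 < T ∧ Real.log 2 / κ - ε ≤ T - (x₀ - X T) := by
  have hq0 : 0 < q x₀ := by rw [← hω₀q]; positivity
  have hXc : Continuous X := continuous_iff_continuousAt.2 fun t => (hX t).continuousAt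
  have hξc : Continuous ξ := continuous_iff_continuousAt.2 fun t => (hξ t).continuousAt
  have hdq : Continuous (deriv q) := hq.continuous_deriv (by norm_num)
  /- (1) monotonicity by reflection: `ξ ≤ 0`, `X ≤ x₀` for `t ≥ 0` -/
  have hmono : ∀ t, 0 ≤ t → ξ t ≤ 0 ∧ X t ≤ x₀ := by
    have hXr : ∀ t, HasDerivAt (fun t => -X t) ((-ξ t) / ω₀) t := fun t => by
      have := (hX t).neg; exact this.congr_deriv (by ring)
    have hξr : ∀ t, HasDerivAt (fun t => -ξ t)
        (-(deriv (fun y => q (-y)) (-X t)) / (2 * ω₀)) t := fun t => by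
      have := (hξ t).neg
      refine this.congr_deriv ?_
      rw [deriv_comp_neg, neg_neg]
      ring
    have hq'r : ∀ y, -xc ≤ y → deriv (fun y => q (-y)) y ≤ 0 := fun y hy => by
      rw [deriv_comp_neg]
      have := hq' (-y) (by linarith)
      linarith
    have h := trajectory_monotone (q := fun y => q (-y)) (xc := -xc) (X₀ := -x₀) hω₀ hXr hξr hq'r
      (by rw [hX0]) (by rw [hξ0, neg_zero]) (by linarith)
    intro t ht
    obtain ⟨h1, h2⟩ := h t ht
    exact ⟨by linarith, by linarith⟩
  refine ⟨fun t ht => (hmono t ht).2, ?_⟩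
  /- (2) conservation of `ξ² + q(X)` -/
  have hq1 : Differentiable ℝ q := hq.differentiable two_ne_zero
  have hcons : ∀ t, ξ t ^ 2 + q (X t) = q x₀ := by
    have hE : ∀ t, HasDerivAt (fun t => ξ t * ξ t + q (X t)) 0 t := by
      intro t
      have h1 : HasDerivAt (fun t => ξ t * ξ t)
          (-(deriv q (X t)) / (2 * ω₀) * ξ t + ξ t * (-(deriv q (X t)) / (2 * ω₀))) t :=
        (hξ t).mul (hξ t)
      have h2 : HasDerivAt (fun t => q (X t)) (deriv q (X t) * (ξ t / ω₀)) t :=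
        (hq1 (X t)).hasDerivAt.comp t (hX t)
      have := h1.add h2
      refine this.congr_deriv ?_
      field_simp
      ring
    intro t
    have h := is_const_of_deriv_eq_zero (f := fun t => ξ t * ξ t + q (X t))
      (fun t => (hE t).differentiableAt) (fun t => (hE t).deriv) t 0
    simp only [hξ0, hX0, mul_zero, zero_add] at h
    rw [sq]
    exact h
  /- (3) the fall `u = x₀ − X`: `0 ≤ u′ ≤ √(1 − e^{−2κu})`, `u″ ≥ 0` -/
  have hu' : ∀ t, HasDerivAt (fun t => x₀ - X t) (-(ξ t) / ω₀) t := fun t => by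
    have := (hX t).const_sub x₀; exact this.congr_deriv (by ring)
  have hdu : ∀ t, deriv (fun t => x₀ - X t) t = -(ξ t) / ω₀ := fun t => (hu' t).deriv
  have hu'' : ∀ t, HasDerivAt (fun t => -(ξ t) / ω₀) (deriv q (X t) / (2 * ω₀ ^ 2)) t := fun t => by
    have := ((hξ t).neg).div_const ω₀
    refine this.congr_deriv ?_
    field_simp
  have hspeed : ∀ t, 0 ≤ t → -(ξ t) / ω₀ ≤ Real.sqrt (1 - Real.exp (-(2 * κ * (x₀ - X t)))) := by
    intro t ht
    obtain ⟨hξt, hXt⟩ := hmono t ht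
    have h1 : (-(ξ t) / ω₀) ^ 2 ≤ 1 - Real.exp (-(2 * κ * (x₀ - X t))) := by
      have hc := hcons t
      have hcm := hcmp (X t) hXt
      rw [div_pow, neg_sq, div_le_iff₀ (by positivity), hω₀q]
      nlinarith
    calc -(ξ t) / ω₀ = Real.sqrt ((-(ξ t) / ω₀) ^ 2) := by
          rw [Real.sqrt_sq (div_nonneg (by linarith) hω₀.le)]
      _ ≤ _ := Real.sqrt_le_sqrt h1
  /- (4) a small time `t₁ > 0` with `u′(t₁) > 0` and `u(t₁) + g(u(t₁))` small -/
  intro ε hε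
  -- `u″ > 0` near `t = 0`
  have hu''c : Continuous fun t => deriv q (X t) / (2 * ω₀ ^ 2) := (hdq.comp hXc).div_const _
  have hu''0 : 0 < deriv q (X 0) / (2 * ω₀ ^ 2) := by rw [hX0]; positivity
  obtain ⟨τ, hτ, hτ'⟩ : ∃ τ > 0, ∀ t ∈ Icc 0 τ, 0 < deriv q (X t) / (2 * ω₀ ^ 2) := by
    have hev := hu''c.continuousAt.eventually (lt_mem_nhds hu''0)
    obtain ⟨δ, hδ, hδ'⟩ := Metric.eventually_nhds_iff.1 hev
    refine ⟨δ / 2, by positivity, fun t ht => hδ' ?_⟩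
    rw [dist_zero_right, Real.norm_eq_abs, abs_of_nonneg ht.1]
    linarith [ht.2]
  have hu'pos : ∀ t ∈ Ioc 0 τ, 0 < -(ξ t) / ω₀ := by
    intro t ht
    have hsm := strictMonoOn_of_deriv_pos (convex_Icc 0 τ) (f := fun t => -(ξ t) / ω₀)
      ((hξc.neg.div_const _).continuousOn) (fun s hs => by
        rw [interior_Icc] at hs
        rw [(hu'' s).deriv]
        exact hτ' s ⟨hs.1.le, hs.2.le⟩)
    have h := hsm (left_mem_Icc.2 hτ.le) ⟨ht.1.le, ht.2⟩ ht.1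
    simp only [hξ0, neg_zero, zero_div] at h
    exact h
  -- continuity of `t ↦ u(t) + g(u(t))` at `0`, where it vanishes
  have hGc : Continuous fun t => (x₀ - X t)
      + 1 / κ * Real.log (1 + Real.sqrt (1 - Real.exp (-(2 * κ * (x₀ - X t))))) := by
    refine (continuous_const.sub hXc).add (continuous_const.mul ?_)
    refine Continuous.log ?_ (fun t => by positivity)
    exact continuous_const.add ((continuous_const.sub (Real.continuous_exp.comp
      (continuous_const.mul (continuous_const.sub hXc)).neg)).sqrt)
  obtain ⟨τ₂, hτ₂, hτ₂'⟩ : ∃ τ₂ > 0, ∀ t ∈ Icc 0 τ₂, (x₀ - X t)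
      + 1 / κ * Real.log (1 + Real.sqrt (1 - Real.exp (-(2 * κ * (x₀ - X t))))) < ε / 2 := by
    have h0 : (x₀ - X 0) + 1 / κ * Real.log (1 + Real.sqrt (1 - Real.exp (-(2 * κ * (x₀ - X 0)))))
        < ε / 2 := by
      rw [hX0]; simp; linarith
    have hev := hGc.continuousAt.eventually (gt_mem_nhds h0)
    obtain ⟨δ, hδ, hδ'⟩ := Metric.eventually_nhds_iff.1 hev
    refine ⟨δ / 2, by positivity, fun t ht => hδ' ?_⟩
    rw [dist_zero_right, Real.norm_eq_abs, abs_of_nonneg ht.1]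
    linarith [ht.2]
  set t₁ : ℝ := min τ τ₂ / 2 with ht₁
  have ht₁0 : 0 < t₁ := by rw [ht₁]; positivity
  have ht₁τ : t₁ ≤ τ := by
    rw [ht₁]; linarith [min_le_left τ τ₂, (lt_min hτ hτ₂).le]
  have ht₁τ₂ : t₁ ≤ τ₂ := by
    rw [ht₁]; linarith [min_le_right τ τ₂, (lt_min hτ hτ₂).le]
  have hv₁ : 0 < -(ξ t₁) / ω₀ := hu'pos t₁ ⟨ht₁0, ht₁τ⟩
  have hu₁ : 0 < x₀ - X t₁ := by
    -- `u` is strictly increasing on `[0, τ]`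
    have hsm := strictMonoOn_of_deriv_pos (convex_Icc 0 τ) (f := fun t => x₀ - X t)
      ((continuous_const.sub hXc).continuousOn) (fun s hs => by
        rw [interior_Icc] at hs
        rw [hdu s]
        exact hu'pos s ⟨hs.1, hs.2.le⟩)
    have h := hsm (left_mem_Icc.2 hτ.le) ⟨ht₁0.le, ht₁τ⟩ ht₁0
    simp only [hX0, sub_self] at h
    exact h
  have hsmall := hτ₂' t₁ ⟨ht₁0.le, ht₁τ₂⟩
  /- (5) `u` is convex after `t₁`: `u(t) ≥ u(t₁) + u′(t₁)(t − t₁)`, so `u → ∞` -/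
  have hu'mono : MonotoneOn (fun t => -(ξ t) / ω₀) (Ici 0) := by
    refine monotoneOn_of_deriv_nonneg (convex_Ici 0) ((hξc.neg.div_const _).continuousOn)
      (fun s _ => (hu'' s).differentiableAt.differentiableWithinAt) (fun s hs => ?_)
    rw [interior_Ici] at hs
    rw [(hu'' s).deriv]
    have := hq' (X s) ((hmono s hs.le).2.trans hxc.le)
    positivity
  have hgrowth : ∀ t, t₁ ≤ t → (x₀ - X t₁) + (-(ξ t₁) / ω₀) * (t - t₁) ≤ x₀ - X t := by
    intro t ht
    have h := Convex.mul_sub_le_image_sub_of_le_deriv (convex_Ici t₁) (f := fun t => x₀ - X t)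
      ((continuous_const.sub hXc).continuousOn)
      (fun s _ => (hu' s).differentiableAt.differentiableWithinAt) (C := -(ξ t₁) / ω₀)
      (fun s hs => by
        rw [interior_Ici] at hs
        rw [hdu s]
        exact hu'mono (mem_Ici.2 ht₁0.le) (mem_Ici.2 (ht₁0.le.trans hs.le)) hs.le)
      t₁ (mem_Ici.2 le_rfl) t (mem_Ici.2 ht) ht
    linarith
  /- (6) the comparison clock `G(t) = t − u − g(u)` is non-decreasing on `[t₁, ∞)` -/
  have hupos : ∀ t, t₁ ≤ t → 0 < x₀ - X t := fun t ht => by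
    have := hgrowth t ht
    nlinarith [hv₁, hu₁]
  have hGmono : MonotoneOn (fun t => t - (x₀ - X t)
      - 1 / κ * Real.log (1 + Real.sqrt (1 - Real.exp (-(2 * κ * (x₀ - X t)))))) (Ici t₁) := by
    have hG' : ∀ t, t₁ ≤ t → HasDerivAt (fun t => t - (x₀ - X t)
        - 1 / κ * Real.log (1 + Real.sqrt (1 - Real.exp (-(2 * κ * (x₀ - X t))))))
        (1 - (-(ξ t) / ω₀) - 1 / κ * (κ * (1 / Real.sqrt (1 - Real.exp (-(2 * κ * (x₀ - X t)))) - 1)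
          * (-(ξ t) / ω₀))) t := by
      intro t ht
      have hg := (hasDerivAt_infallClock hκ (hupos t ht)).comp t (hu' t)
      exact (((hasDerivAt_id t).sub (hu' t)).sub (hg.const_mul (1 / κ)))
    refine monotoneOn_of_deriv_nonneg (convex_Ici t₁) ?_ ?_ ?_
    · exact fun t ht => (hG' t ht).continuousAt.continuousWithinAt
    · exact fun t ht => (hG' t (interior_subset ht)).differentiableAt.differentiableWithinAt
    · intro t ht
      rw [interior_Ici] at ht
      rw [(hG' t ht.le).deriv]
      have hs0 : 0 < Real.sqrt (1 - Real.exp (-(2 * κ * (x₀ - X t)))) := by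
        apply Real.sqrt_pos.2
        have : Real.exp (-(2 * κ * (x₀ - X t))) < 1 :=
          Real.exp_lt_one_iff.2 (by nlinarith [hupos t ht.le])
        linarith
      have hsp := hspeed t (ht₁0.le.trans ht.le)
      have hv0 : 0 ≤ -(ξ t) / ω₀ := div_nonneg (by linarith [(hmono t (ht₁0.le.trans ht.le)).1]) hω₀.le
      have e : 1 - (-(ξ t) / ω₀) - 1 / κ * (κ * (1 / Real.sqrt (1 - Real.exp (-(2 * κ * (x₀ - X t)))) - 1)
          * (-(ξ t) / ω₀)) = 1 - (-(ξ t) / ω₀) / Real.sqrt (1 - Real.exp (-(2 * κ * (x₀ - X t)))) := by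
        field_simp
        ring
      rw [e, sub_nonneg, div_le_one hs0]
      exact hsp
  /- (7) choose the time -/
  obtain ⟨V, hV0, hV⟩ := infallClock_eventually_ge hκ (half_pos hε)
  set T : ℝ := t₁ + (V + 1) / (-(ξ t₁) / ω₀) with hT
  have hTt₁ : t₁ ≤ T := by
    rw [hT]
    have : 0 ≤ (V + 1) / (-(ξ t₁) / ω₀) := div_nonneg (by linarith) hv₁.le
    linarith
  have hT0 : 0 < T := lt_of_lt_of_le ht₁0 hTt₁
  have huT : V ≤ x₀ - X T := by
    have h := hgrowth T hTt₁
    have : (-(ξ t₁) / ω₀) * (T - t₁) = V + 1 := by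
      rw [hT, add_sub_cancel_left, mul_div_cancel₀ _ hv₁.ne']
    linarith [hu₁]
  refine ⟨T, hT0, ?_⟩
  have hG := hGmono (mem_Ici.2 le_rfl) (mem_Ici.2 hTt₁) hTt₁
  simp only at hG
  have hclock := hV (x₀ - X T) huT
  linarith [hsmall, hclock, hG]

end Literature.Analysis.ODE
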